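import Summits.QuantumAdvantage.QuantumAdvantage.Theorems.LinnikCubicClassGroupsDegreeOnePrimesEscapeLeastPrimeIdeal
import Literature.NumberTheory.LFunctions.DegreeOnePrimesPNT
import Literature.NumberTheory.LFunctions.UniformClassGroupPNTChebyshev
import Mathlib.RingTheory.IntegralDomain
import HarnessLib

/-!
# Lemmas for the cubic Chebotarev–Linnik theorem (least inert prime)

Topic `Summits/QuantumAdvantage/QuantumAdvantage/Theorems`, cell B2b-1 (linnik-cubic), PART A (gen 7);
helper toward the crux `DegreeOnePrimesEscape` (stmt-QuantumAdvantage-11543) of route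
`LinnikCubicClassGroups`.  HONEST FRAMING: the value of this file is a THEOREM (real-variable and
class-sum bookkeeping) — NOT summit progress.

* `chebyshevThetaIdeal_ge_of_classBound`, `…_char` — from per-class relative bounds to `θ_K ≥ (1−η)·main`;
* `quadratic_junk_le` — `θ_k − θ¹_k ≤ 2·10⁷ x^{5/8}` for a quadratic field;
* `mul_rpow_le_rpow_of_logb` — choice of exponents `B d^e ≤ d^t`;
* `inertSum_pos_F1`, `inertSum_pos_F3` — the two linear bookkeeping steps;
* `window_of_small_mainTerm` — in the Landau–Siegel regime `x − x^β/β < x/3` the zero `β` lies in the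
  Landau–Page window of the sextic field once `log x ≥ (log|d_N| + log 4)/c`;
* `mainTerm_ge_of_stark` — `x − x^β/β ≫ x Q^{−2}` from Stark's effective bound.
-/

noncomputable section

open scoped NumberField nonZeroDivisors
open Finset Real Ideal NumberField
open Literature.NumberTheory.NumberFields Literature.NumberTheory.LFunctions
  Literature.NumberTheory.LFunctions.NumberField

namespace Summit.QuantumAdvantage.QuantumAdvantage.Theorems.DegreeOnePrimesEscape

/-! ### Small analytic lemmas -/

/-- From per-class relative bounds with a COMMON main term to a lower bound for `θ_K`:
if `|θ_C − M/h| ≤ η M/h` for all classes then `(1 − η) M ≤ θ_K`. -/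
theorem chebyshevThetaIdeal_ge_of_classBound (K : Type) [Field K] [NumberField K] {η x M : ℝ}
    (h : ∀ C, |chebyshevThetaIdealClass K C x - M / NumberField.classNumber K| ≤
      η * M / NumberField.classNumber K) :
    (1 - η) * M ≤ chebyshevThetaIdeal K x := by
  classical
  set hK : ℝ := (NumberField.classNumber K : ℝ) with hh
  have hh1 : 1 ≤ hK := by rw [hh]; exact_mod_cast one_le_classNumber (K := K)
  have hh0 : 0 < hK := by linarith
  have hcard : (Fintype.card (ClassGroup (𝓞 K)) : ℝ) = hK := by
    rw [hh, show NumberField.classNumber K = Fintype.card (ClassGroup (𝓞 K)) from rfl]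
  rw [← sum_chebyshevThetaIdealClass K x]
  have hC : ∀ C, (1 - η) * M / hK ≤ chebyshevThetaIdealClass K C x := by
    intro C
    have := (abs_le.mp (h C)).1
    have e : (1 - η) * M / hK = M / hK - η * M / hK := by ring
    rw [e]; linarith
  calc (1 - η) * M = ∑ _C : ClassGroup (𝓞 K), (1 - η) * M / hK := by
        rw [Finset.sum_const, Finset.card_univ, nsmul_eq_mul, hcard]; field_simp
    _ ≤ ∑ C, chebyshevThetaIdealClass K C x := Finset.sum_le_sum fun C _ ↦ hC C

/-- The same with the main terms `x − χ₁(C) x^{β}/β` of a NON-trivial real character: they sum to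
`h x` (orthogonality), so `(1 − η) x ≤ θ_K`. -/
theorem chebyshevThetaIdeal_ge_of_classBound_char (K : Type) [Field K] [NumberField K] {η x β : ℝ}
    {χ₁ : ClassGroup (𝓞 K) →* ℂˣ} (hχ1 : χ₁ ≠ 1)
    (h : ∀ C, |chebyshevThetaIdealClass K C x -
        (x - ((χ₁ C : ℂ)).re * x ^ β / β) / NumberField.classNumber K| ≤
      η * (x - ((χ₁ C : ℂ)).re * x ^ β / β) / NumberField.classNumber K) :
    (1 - η) * x ≤ chebyshevThetaIdeal K x := by
  classical
  set hK : ℝ := (NumberField.classNumber K : ℝ) with hh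
  have hh1 : 1 ≤ hK := by rw [hh]; exact_mod_cast one_le_classNumber (K := K)
  have hh0 : 0 < hK := by linarith
  have hcard : (Fintype.card (ClassGroup (𝓞 K)) : ℝ) = hK := by
    rw [hh, show NumberField.classNumber K = Fintype.card (ClassGroup (𝓞 K)) from rfl]
  have hψ : (Units.coeHom ℂ).comp χ₁ ≠ 1 := by
    intro heq; apply hχ1; ext C; have := DFunLike.congr_fun heq C; simpa using this
  have hS : ∑ C : ClassGroup (𝓞 K), ((χ₁ C : ℂ)).re = 0 := by
    have h0 := sum_hom_units_eq_zero ((Units.coeHom ℂ).comp χ₁) hψ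
    rw [← Complex.re_sum]
    have : ∑ C : ClassGroup (𝓞 K), (χ₁ C : ℂ) = ∑ C : ClassGroup (𝓞 K), ((Units.coeHom ℂ).comp χ₁) C :=
      Finset.sum_congr rfl fun C _ => rfl
    rw [this, h0, Complex.zero_re]
  rw [← sum_chebyshevThetaIdealClass K x]
  have hC : ∀ C, (1 - η) * (x - ((χ₁ C : ℂ)).re * x ^ β / β) / hK ≤ chebyshevThetaIdealClass K C x := by
    intro C
    have := (abs_le.mp (h C)).1
    have e : (1 - η) * (x - ((χ₁ C : ℂ)).re * x ^ β / β) / hK =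
        (x - ((χ₁ C : ℂ)).re * x ^ β / β) / hK - η * (x - ((χ₁ C : ℂ)).re * x ^ β / β) / hK := by ring
    rw [e]; linarith
  have hsum : ∑ C : ClassGroup (𝓞 K), (1 - η) * (x - ((χ₁ C : ℂ)).re * x ^ β / β) / hK = (1 - η) * x := by
    have e : ∀ C : ClassGroup (𝓞 K), (1 - η) * (x - ((χ₁ C : ℂ)).re * x ^ β / β) / hK =
        (1 - η) * x / hK - ((χ₁ C : ℂ)).re * ((1 - η) * (x ^ β / β) / hK) := fun C ↦ by ring
    rw [Finset.sum_congr rfl fun C _ ↦ e C, Finset.sum_sub_distrib, Finset.sum_const, Finset.card_univ,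
      nsmul_eq_mul, hcard, ← Finset.sum_mul, hS, zero_mul, sub_zero]
    field_simp
  calc (1 - η) * x = ∑ C : ClassGroup (𝓞 K), (1 - η) * (x - ((χ₁ C : ℂ)).re * x ^ β / β) / hK := hsum.symm
    _ ≤ ∑ C, chebyshevThetaIdealClass K C x := Finset.sum_le_sum fun C _ ↦ hC C

/-- The junk of a quadratic field is small: `θ_k(x) − θ¹_k(x) ≤ 2·10⁷ · x^{5/8}` for `x ≥ 1`
(prime ideals of non-prime norm; `log x ≤ 32 x^{1/32}`). -/
theorem quadratic_junk_le (k : Type) [Field k] [NumberField k] (hk : Module.finrank ℚ k = 2) {x : ℝ}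
    (hx : 1 ≤ x) :
    chebyshevThetaIdeal k x - degreeOneTheta k x ≤ 2 * 10 ^ 7 * x ^ (5 / 8 : ℝ) := by
  have h := chebyshevThetaIdeal_sub_degreeOneTheta_le k hx
  rw [hk] at h
  have hx0 : 0 < x := by linarith
  have hl2 : Real.log 2 > 0.6931471803 := Real.log_two_gt_d9
  have hl2' : 0 < Real.log 2 := by linarith
  have hL0 : 0 ≤ Real.log x := Real.log_nonneg hx
  set y : ℝ := x ^ (1 / 32 : ℝ) with hy
  have hy1 : 1 ≤ y := Real.one_le_rpow hx (by norm_num)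
  have hy0 : 0 ≤ y := by linarith
  have hlogy : Real.log x ≤ 32 * y := by
    have := Real.log_le_rpow_div hx0.le (by norm_num : (0 : ℝ) < 1 / 32)
    rw [← hy] at this; linarith
  have hℓ : Real.log x / Real.log 2 ≤ 64 * y := by
    rw [div_le_iff₀ hl2']; nlinarith
  have hℓ1 : Real.log x / Real.log 2 + 1 ≤ 65 * y := by linarith
  have hℓ0 : 0 ≤ Real.log x / Real.log 2 := div_nonneg hL0 hl2'.le
  have hsqrt : Real.sqrt x = y ^ (16 : ℕ) := by
    rw [hy, ← Real.rpow_natCast, ← Real.rpow_mul hx0.le, Real.sqrt_eq_rpow]; norm_num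
  have hx58 : x ^ (5 / 8 : ℝ) = y ^ (20 : ℕ) := by
    rw [hy, ← Real.rpow_natCast, ← Real.rpow_mul hx0.le]; norm_num
  have h16 : 0 ≤ y ^ (16 : ℕ) := pow_nonneg hy0 16
  calc chebyshevThetaIdeal k x - degreeOneTheta k x
      ≤ (Real.log x / Real.log 2 + 1) ^ 2 * (Real.log x / Real.log 2) *
          (2 * Real.sqrt x * Real.log x) := h
    _ ≤ (65 * y) ^ 2 * (64 * y) * (2 * y ^ (16 : ℕ) * (32 * y)) := by
        rw [hsqrt]
        apply mul_le_mul (mul_le_mul (pow_le_pow_left₀ (by positivity) hℓ1 2) hℓ hℓ0 (by positivity))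
          _ (by positivity) (by positivity)
        have : 2 * y ^ (16 : ℕ) * Real.log x ≤ 2 * y ^ (16 : ℕ) * (32 * y) :=
          mul_le_mul_of_nonneg_left hlogy (by positivity)
        linarith
    _ = 17305600 * y ^ (20 : ℕ) := by ring
    _ ≤ 2 * 10 ^ 7 * x ^ (5 / 8 : ℝ) := by rw [hx58]; nlinarith [pow_nonneg hy0 20]

/-- **Choice of exponents**: for `d ≥ 3`, `B ≥ 1`, `e ≥ 0` and `t ≥ e + log_3 B`: `B · d^e ≤ d^t`. -/
theorem mul_rpow_le_rpow_of_logb {d B e t : ℝ} (hd : 3 ≤ d) (hB : 1 ≤ B)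
    (ht : e + Real.logb 3 B ≤ t) : B * d ^ e ≤ d ^ t := by
  have hd0 : 0 < d := by linarith
  have hd1 : 1 ≤ d := by linarith
  have hlB : 0 ≤ Real.logb 3 B := Real.logb_nonneg (by norm_num) hB
  calc B * d ^ e = (3 : ℝ) ^ Real.logb 3 B * d ^ e := by
        rw [Real.rpow_logb (by norm_num) (by norm_num) (by linarith)]
    _ ≤ d ^ Real.logb 3 B * d ^ e :=
        mul_le_mul_of_nonneg_right (Real.rpow_le_rpow (by norm_num) hd hlB) (Real.rpow_nonneg hd0.le e)
    _ = d ^ (e + Real.logb 3 B) := by rw [Real.rpow_add hd0]; ring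
    _ ≤ d ^ t := Real.rpow_le_rpow_of_exponent_le hd1 ht

/-- Bookkeeping of the `(ℚ, k, K)`-count: `θ + θ¹_k − θ¹_K − 3ℓ ≤ 3S` with `θ ≥ 0.95x`,
`θ¹_k ≥ 0.31x − J`, `θ¹_K ≤ 1.05x`, `J ≤ x/10`, `3ℓ ≤ x/10`, `x > 0` forces `S > 0`. -/
theorem inertSum_pos_F1 {S T Tk TK ℓ J x : ℝ} (hsum : T + Tk - TK - 3 * ℓ ≤ 3 * S)
    (hT : (1 - 1 / 20) * x ≤ T) (hTk : 31 / 100 * x - J ≤ Tk) (hTK : TK ≤ (1 + 1 / 20) * x)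
    (hJ : J ≤ x / 10) (hℓ : 3 * ℓ ≤ x / 10) (hx : 0 < x) : 0 < S := by
  nlinarith

/-- Bookkeeping of the `(k, N)`-count: `3θ¹_k − θ¹_N − 6ℓ ≤ 6S` with `θ¹_k ≥ 0.95M − J`,
`θ¹_N ≤ 1.05M`, `q/4 ≤ M`, `3J ≤ q/5`, `6ℓ ≤ q/5`, `q > 0` forces `S > 0`. -/
theorem inertSum_pos_F3 {S Tk TN M ℓ J q : ℝ} (hsum : 3 * Tk - TN - 6 * ℓ ≤ 6 * S)
    (hTk : (1 - 1 / 20) * M - J ≤ Tk) (hTN : TN ≤ (1 + 1 / 20) * M) (hM : q / 4 ≤ M)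
    (hJ : 3 * J ≤ q / 5) (hℓ : 6 * ℓ ≤ q / 5) (hq : 0 < q) : 0 < S := by
  nlinarith

/-- **The Landau–Siegel regime puts `β` in the Landau–Page window of `N`**: if
`x − x^β/β < x/3` with `3/4 ≤ β < 1`, `x > 1`, and `log x ≥ (ℓ + log 4)/c` (`ℓ ≥ 0`, `c > 0`), then
`1 − c/(ℓ + log 4) < β`. -/
theorem window_of_small_mainTerm {x β ℓ c : ℝ} (hx : 1 < x) (hβ : 3 / 4 ≤ β) (hβ1 : β < 1)
    (hM : x - x ^ β / β < x / 3) (hℓ : 0 ≤ ℓ) (hc : 0 < c) (hlog : (ℓ + Real.log 4) / c ≤ Real.log x) :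
    1 - c / (ℓ + Real.log 4) < β := by
  have hx0 : 0 < x := by linarith
  have hlogx : 0 < Real.log x := Real.log_pos hx
  have hβ0 : 0 < β := by linarith
  have hpow : 0 < x ^ β := Real.rpow_pos_of_pos hx0 β
  -- `x^β > x/2`
  have hxβ : x / 2 < x ^ β := by
    have h1 : 2 * x / 3 < x ^ β / β := by linarith
    have h2 : x ^ β = β * (x ^ β / β) := by field_simp
    rw [h2]; nlinarith
  -- `(1 − β) log x < log 2 < 1`
  have hlt : (1 - β) * Real.log x < 1 := by
    have h1 : x ^ (β - 1) = x ^ β / x := by rw [Real.rpow_sub hx0, Real.rpow_one]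
    have h2 : (1 : ℝ) / 2 < x ^ (β - 1) := by rw [h1, lt_div_iff₀ hx0]; linarith
    have h3 : Real.log (1 / 2) < (β - 1) * Real.log x := by
      have := Real.log_lt_log (by norm_num) h2
      rwa [Real.log_rpow hx0] at this
    have h4 : Real.log (1 / 2) = -Real.log 2 := by rw [one_div, Real.log_inv]
    have h5 : Real.log 2 < 1 := by have := Real.log_two_lt_d9; linarith
    nlinarith
  have hlog4 : 0 < Real.log 4 := Real.log_pos (by norm_num)
  have hden : 0 < ℓ + Real.log 4 := by linarith
  have h1 : 1 - β < 1 / Real.log x := by rw [lt_div_iff₀ hlogx]; exact hlt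
  have h2 : 1 / Real.log x ≤ c / (ℓ + Real.log 4) := by
    rw [div_le_div_iff₀ hlogx hden]
    rw [div_le_iff₀ hc] at hlog
    linarith
  linarith

/-- **The main term is `≫ x Q^{−2}`** (Stark's effective bound fed into `x − x^β/β ≥ (x/4)min(1, (1−β)log x)`):
from `x/4 · min(1, (1−β) log x) ≤ M`, `c₁ q ≤ 1 − β` with `c₁ ≤ 1`, `q ≤ 1`, `q > 0`, `log x ≥ 1`:
`x/4 · (c₁ q) ≤ M`. -/
theorem mainTerm_ge_of_stark {x β M c₁ q : ℝ} (hx : 0 ≤ x) (hM : x / 4 * min 1 ((1 - β) * Real.log x) ≤ M)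
    (hδ : c₁ * q ≤ 1 - β) (hc₁ : c₁ ≤ 1) (hc₁0 : 0 ≤ c₁) (hq : q ≤ 1) (hq0 : 0 ≤ q)
    (hlog : 1 ≤ Real.log x) : x / 4 * (c₁ * q) ≤ M := by
  have hmin : c₁ * q ≤ min 1 ((1 - β) * Real.log x) := by
    refine le_min ?_ ?_
    · calc c₁ * q ≤ 1 * 1 := mul_le_mul hc₁ hq hq0 zero_le_one
        _ = 1 := one_mul 1
    · have : (1 - β) * 1 ≤ (1 - β) * Real.log x := mul_le_mul_of_nonneg_left hlog (by nlinarith)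
      linarith
  exact le_trans (mul_le_mul_of_nonneg_left hmin (by positivity)) hM

end Summit.QuantumAdvantage.QuantumAdvantage.Theorems.DegreeOnePrimesEscape

end
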